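import Summits.Langlands.Langlands.Theorems.ParityBlindBianchiArtinWeightRealisationEvenStubTwistedRealisation
import HarnessLib

/-!
# Stub `stub_twistedRealisationFin` (S5fin) of the line `SketchIdeator2` for the crux
# `ParityBlindBianchi.ArtinWeightRealisationEven` (item stmt-Langlands-16619)

Twisting back by a finite-order character.  Let `K` be a number field, `ι : ℚ̄_p ≃+* ℂ`,
`σ r : Γ_K →ₜ* GL₂(ℚ̄_p)`, `χ : Γ_K →* ℚ̄_pˣ` with FINITE IMAGE and `M ∈ GL₂(ℚ̄_p)` with
`r(g) = χ(g) · M σ(g) M⁻¹` for all `g`, and let `π` be a cuspidal automorphic representation of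
`GL₂(𝔸_K)` which is Satake–Frobenius compatible with `r` (`Summit.Langlands.SatakeFrobCompatibleAt`,
arithmetic normalisation) at every good place `w` (a place above no prime of `S₀`), where moreover
`σ` is unramified.  Then the twist `π ⊗ (ω ∘ det)` of `π` by the finite-order Hecke character `ω`
attached to `χ` by Artin reciprocity is Satake–Frobenius compatible with `σ` at every good place.

This is the landed S5 `stub_twistedRealisation` (same folder, hypothesis `χ² = 1`) with `χ² = 1`
replaced by `Finite χ.range`; only Step 1 of the proof changes.

Proof.
1. `g ↦ χ(g) = (r(g) (M σ(g) M⁻¹)⁻¹)₀₀` is continuous (`TwistedRealisation.eq_mul_inv_apply`) with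
   finite set of values `F ⊆ ℚ̄_p`; `F \ {1}` is finite, hence closed in the Hausdorff space `ℚ̄_p`,
   so its preimage is closed, and `ker χ` is the complement of that preimage: `ker χ` is open.
   Hence `g ↦ ι(χ(g)) ∈ ℂˣ = GL₁(ℂ)` is a rank-one framed Artin representation `χℂ`
   (`MonoidHom.continuous_of_isOpen_ker`, `FramedRep.unitsContinuousMulEquivOfUnique`).
2. At a good place `w`, `r` and `σ` are trivial on the inertia groups above `w`, so
   `χ(τ) · 1 = r(τ) (M σ(τ) M⁻¹)⁻¹ = 1` (`TwistedRealisation.eq_one_of_eq_smul_conj`): `χℂ` is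
   unramified at `w`.
3. Artin reciprocity (`artinReciprocity_character_holds`, proved in the tree) gives a finite-order
   Hecke character `ω`, unramified at every such `w`, with `ι(χ(Φ)) = ω(ϖ_w)` for every arithmetic
   Frobenius `Φ` above `w` (`exists_heckeCharacter_apply_frob_eq`).
4. The Borel–Jacquet twist `π ⊗ (ω ∘ det)` (`CuspidalAutomorphicRepData.twist`) has Satake
   parameter `ω(ϖ_w) · α` at `w` (`HasSatakeParamAt.twist_of_isUnramifiedAt`, at a level of `ω`
   prime to `w`, `HeckeCharacter.exists_level_not_dvd_of_isUnramifiedAt`).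
5. `charpoly σ(Φ) = charpoly (M σ(Φ) M⁻¹) = charpoly (χ(Φ)⁻¹ · r(Φ))`, whose roots are those of
   `charpoly r(Φ) = ∏ (X - ι⁻¹(α_j⁻¹))` multiplied by `χ(Φ)⁻¹ = ι⁻¹(ω(ϖ_w)⁻¹)`
   (`TwistedRealisation.charpoly_eq_of_eq_smul_conj`), i.e. `∏ (X - ι⁻¹((ω(ϖ_w) α_j)⁻¹))`, the
   arithmetic Frobenius polynomial of the Satake parameter `ω(ϖ_w) · α`
   (`arithFrobPolyOfSatake_one_map_mul`, `arithFrobPolyOfSatake_one_eq_prod_map`).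

References: J. Tate, *Global class field theory*, in Cassels–Fröhlich (1967), Ch. VII §5.1;
J. Arthur, L. Clozel, Ann. of Math. Stud. 120 (1989), Ch. 3, p. 172 (`t_{π ⊗ η, v} = η(ϖ_v) t_{π,v}`);
J.-P. Serre, *Abelian ℓ-adic representations* (1968), Ch. I §1.1, §2.3.
-/

-- the line's namespace `Summit.Langlands.Langlands.…` (summit = problem = `Langlands`) repeats a
-- component by design
set_option linter.dupNamespace false

namespace Summit.Langlands.Langlands.Theorems.ArtinWeightRealisationEven

open scoped MatrixGroups Matrix Polynomial NumberField
open NumberField IsDedekindDomain Polynomial Field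
open Literature.NumberTheory.Automorphic Literature.NumberTheory.GaloisRepresentations

namespace TwistedRealisation

/-- **Open kernel of a continuous finite-valued character.**  If `χ : Γ →* Aˣ` has finite image and
`g ↦ (χ g : A)` is continuous into a `T₁` space `A`, then `ker χ` is open: it is the complement of
the preimage of the finite (hence closed) set `χ(Γ) \ {1}`. [folklore] -/
theorem isOpen_ker_of_finite_range {Γ : Type*} [Group Γ] [TopologicalSpace Γ] {A : Type*}
    [Monoid A] [TopologicalSpace A] [T1Space A] (χ : Γ →* Aˣ) (hfin : Finite χ.range)
    (hf : Continuous fun g : Γ => ((χ g : Aˣ) : A)) : IsOpen (χ.ker : Set Γ) := by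
  have hF : (Set.range fun g : Γ => ((χ g : Aˣ) : A)).Finite := by
    refine (Set.finite_range fun x : χ.range => ((x : Aˣ) : A)).subset ?_
    rintro _ ⟨g, rfl⟩
    exact ⟨⟨χ g, MonoidHom.mem_range.mpr ⟨g, rfl⟩⟩, rfl⟩
  have h1 : (χ.ker : Set Γ) =
      ((fun g : Γ => ((χ g : Aˣ) : A)) ⁻¹'
        ((Set.range fun g : Γ => ((χ g : Aˣ) : A)) \ {1}))ᶜ := by
    ext g
    simp only [SetLike.mem_coe, MonoidHom.mem_ker, Set.mem_compl_iff, Set.mem_preimage,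
      Set.mem_sdiff, Set.mem_singleton_iff]
    constructor
    · rintro hg ⟨_, hne⟩
      exact hne (by rw [hg, Units.val_one])
    · intro hg
      by_contra hne
      exact hg ⟨Set.mem_range_self g, fun h => hne (Units.val_eq_one.mp h)⟩
  rw [h1, isOpen_compl_iff]
  exact hF.sdiff.isClosed.preimage hf

end TwistedRealisation

open TwistedRealisation
open Summit.Langlands.Langlands.Theorems.ArtinWeightRealisationLevel
  (arithFrobPolyOfSatake_one_eq_prod_map arithFrobPolyOfSatake_one_map_mul)

/-- **S5fin (twisting back by a finite-order character).**  If `r = χ · M σ M⁻¹` with `χ` of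
finite image and a cuspidal `π` of `GL₂(𝔸_K)` is Satake–Frobenius compatible with `r` at every
good place (where `σ` is unramified), then the Borel–Jacquet twist `π ⊗ (ω ∘ det)` of `π` by the
finite-order Hecke character `ω` attached by Artin reciprocity (`artinReciprocity_character_holds`)
to the complex character `ι ∘ χ` (continuous: its kernel is open, being the complement of the
preimage of the finite closed set `χ(Γ_K) \ {1}` under the continuous `g ↦ χ(g) = (r(g)(Mσ(g)M⁻¹)⁻¹)₀₀`)
is Satake–Frobenius compatible with `σ` at every good place: at such a `w`,
`ι(χ(Frob_w)) = ω(ϖ_w)`, the Satake parameter of the twist is `ω(ϖ_w) · α`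
(`HasSatakeParamAt.twist_of_isUnramifiedAt`), and
`charpoly σ(Frob_w) = charpoly (χ(Frob_w)⁻¹ r(Frob_w))` has the roots `ι⁻¹((ω(ϖ_w) α_j)⁻¹)`.
Tate, Cassels–Fröhlich Ch. VII §5.1; Arthur–Clozel (1989), Ch. 3, p. 172. [folklore] -/
theorem stub_twistedRealisationFin :
    ∀ (K : Type) [Field K] [NumberField K] (p : ℕ) [Fact p.Prime] (ι : PadicAlgCl p ≃+* ℂ)
      (σ r : FramedGaloisRep K (PadicAlgCl p) 2) (χ : absoluteGaloisGroup K →* (PadicAlgCl p)ˣ)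
      (M : GL (Fin 2) (PadicAlgCl p)), Finite χ.range →
      (∀ g : absoluteGaloisGroup K, ((r g : GL (Fin 2) (PadicAlgCl p)) : Matrix (Fin 2) (Fin 2) (PadicAlgCl p)) =
        ((χ g : (PadicAlgCl p)ˣ) : PadicAlgCl p) •
          ((M * σ g * M⁻¹ : GL (Fin 2) (PadicAlgCl p)) : Matrix (Fin 2) (Fin 2) (PadicAlgCl p))) →
      ∀ (S₀ : Finset ℕ) (hcpt : isCompact_glFiniteIntegralLevel 2 K) (π : CuspidalAutomorphicRepData 2 K hcpt),
      (∀ w : HeightOneSpectrum (𝓞 K), (∀ ℓ ∈ S₀, ((ℓ : ℕ) : 𝓞 K) ∉ w.asIdeal) →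
        σ.IsUnramifiedAt w ∧ SatakeFrobCompatibleAt ι π.1 r w) →
      ∃ (hcpt' : isCompact_glFiniteIntegralLevel 2 K) (π' : CuspidalAutomorphicRepData 2 K hcpt'),
        ∀ w : HeightOneSpectrum (𝓞 K), (∀ ℓ ∈ S₀, ((ℓ : ℕ) : 𝓞 K) ∉ w.asIdeal) →
          SatakeFrobCompatibleAt ι π'.1 σ w := by
  intro K _ _ p _ ι σ r χ M hχfin hrχ S₀ hcpt π hgood
  -- Step 1: `χ` is continuous with finite image, i.e. has open kernel
  have hNc : Continuous fun g : absoluteGaloisGroup K =>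
      (M * σ g * M⁻¹ : GL (Fin 2) (PadicAlgCl p)) :=
    (continuous_const.mul (map_continuous σ)).mul continuous_const
  have hc : Continuous fun g : absoluteGaloisGroup K =>
      (((r g : GL (Fin 2) (PadicAlgCl p)) : Matrix (Fin 2) (Fin 2) (PadicAlgCl p)) *
        (((M * σ g * M⁻¹)⁻¹ : GL (Fin 2) (PadicAlgCl p)) : Matrix (Fin 2) (Fin 2) (PadicAlgCl p))) 0 0 :=
    ((Units.continuous_val.comp (map_continuous r)).matrix_mul
      (Units.continuous_coe_inv.comp hNc)).matrix_elem 0 0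
  have hf : Continuous fun g : absoluteGaloisGroup K => ((χ g : (PadicAlgCl p)ˣ) : PadicAlgCl p) :=
    hc.congr fun g => (eq_mul_inv_apply (A := PadicAlgCl p) (hrχ g)).symm
  have hker : IsOpen (χ.ker : Set (absoluteGaloisGroup K)) :=
    isOpen_ker_of_finite_range χ hχfin hf
  -- Step 2: the complex character `ι ∘ χ` as a rank-one framed Artin representation
  set θ : absoluteGaloisGroup K →* ℂˣ := (Units.map (ι : PadicAlgCl p →* ℂ)).comp χ with hθdef
  have hθ : ∀ g : absoluteGaloisGroup K,
      ((θ g : ℂˣ) : ℂ) = ι ((χ g : (PadicAlgCl p)ˣ) : PadicAlgCl p) := fun g => by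
    rw [hθdef, MonoidHom.comp_apply, Units.coe_map]
    rfl
  have hθker : IsOpen (θ.ker : Set (absoluteGaloisGroup K)) := by
    refine Subgroup.isOpen_mono (fun g hg => ?_) hker
    rw [MonoidHom.mem_ker] at hg ⊢
    rw [hθdef, MonoidHom.comp_apply, hg, map_one]
  obtain ⟨χℂ, hχℂ⟩ : ∃ χℂ : FramedArtinRep K 1, ∀ g : absoluteGaloisGroup K,
      ((χℂ g : GL (Fin 1) ℂ) : Matrix (Fin 1) (Fin 1) ℂ) 0 0 =
        ι ((χ g : (PadicAlgCl p)ˣ) : PadicAlgCl p) :=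
    ⟨ContinuousMonoidHom.comp
        (FramedRep.unitsContinuousMulEquivOfUnique (Fin 1) ℂ : ℂˣ →ₜ* GL (Fin 1) ℂ)
        ⟨θ, Literature.NumberTheory.Automorphic.MonoidHom.continuous_of_isOpen_ker θ hθker⟩,
      fun g => by rw [← hθ g]; rfl⟩
  -- Step 3: Artin reciprocity
  obtain ⟨ω, hωfin, hω⟩ :=
    exists_heckeCharacter_apply_frob_eq artinReciprocity_character_holds χℂ
  -- Step 4: the twist `π ⊗ (ω ∘ det)` realises `σ` at every good place
  refine ⟨hcpt, π.twist ω hωfin, fun w hw => ?_⟩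
  obtain ⟨hσw, α, hα, hrw, hrchar⟩ := hgood w hw
  -- `χℂ` is unramified at `w`
  have hχw : χℂ.IsUnramifiedAt w := by
    intro 𝔓 h𝔓 τ hτ
    have h1 : ((χ τ : (PadicAlgCl p)ˣ) : PadicAlgCl p) = 1 :=
      eq_one_of_eq_smul_conj (A := PadicAlgCl p) (hrw 𝔓 h𝔓 τ hτ) (hσw 𝔓 h𝔓 τ hτ) (hrχ τ)
    refine Units.ext (Matrix.ext fun i j => ?_)
    have hi := Fin.fin_one_eq_zero i
    have hj := Fin.fin_one_eq_zero j
    subst hi hj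
    rw [hχℂ τ, h1, map_one, Units.val_one, Matrix.one_apply_eq]
  obtain ⟨hωw, hωfrob⟩ := hω w hχw
  obtain ⟨𝔪, h𝔪, hw𝔪, hω𝔪⟩ := HeckeCharacter.exists_level_not_dvd_of_isUnramifiedAt 2 hωw
  have hS : (π.twist ω hωfin).1.HasSatakeParamAt w (α.map (ω.valueAtUniformizer w * ·)) :=
    hα.twist_of_isUnramifiedAt hωfin h𝔪 hω𝔪 hw𝔪 hωw
  -- Step 5: the Frobenius polynomial of `σ` at `w`
  refine ⟨α.map (ω.valueAtUniformizer w * ·), hS, hσw, ?_⟩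
  rw [arithFrobPolyOfSatake_one_map_mul]
  intro 𝔓 h𝔓 Φ hΦ
  have hrΦ := hrchar 𝔓 h𝔓 Φ hΦ
  rw [arithFrobPolyOfSatake_one_eq_prod_map] at hrΦ
  have hχΦ : ((χ Φ : (PadicAlgCl p)ˣ) : PadicAlgCl p) = ι.symm (ω.valueAtUniformizer w) := by
    rw [← hωfrob 𝔓 h𝔓 Φ hΦ, hχℂ Φ, RingEquiv.symm_apply_apply]
  have hχΦ' : ((χ Φ : (PadicAlgCl p)ˣ) : PadicAlgCl p)⁻¹ = ι.symm (ω.valueAtUniformizer w)⁻¹ := by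
    rw [hχΦ, map_inv₀]
  have key := charpoly_eq_of_eq_smul_conj (A := PadicAlgCl p) (χ Φ).ne_zero (hrχ Φ) hrΦ
  rw [hχΦ'] at key
  exact key

end Summit.Langlands.Langlands.Theorems.ArtinWeightRealisationEven
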